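import Summits.QuantumFields.BalabanUV.T4Continuum.Support.CovariantVectorCoerciveHolo

/-!
# NE9ChartRadiusScaling — ROW NE9 OWNER'S ANSWER TO Q-S15 («may the `analyticClass` ∕ `HoloRadiusCompat` radius depend on the
# level?»), KERNEL PART: the SCALING FORM `ρ_j = ρ₀ / n_j` of a level-dependent chart radius is what the END's level-free gain
# letter `cdir` and room binder need — it is SUFFICIENT (a level-free gain), one MORE inverse power of the level is NOT
# (no level-free gain exists), and compatibility of two scaling-form radii is the level-free scalar inequality of their prefactors
# (cell `pub-balaban`, T4-DAG §2 node U3 ∕ §6 NE9; BINDER row NE9 OWNER lineage `b2b-balaban-t4-ne9-p1`, generation 32;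
# substrate MAP v0.6.1 §5 Q-S15 (typer l.15407), substrate-p3 INFO l.15370; sheet `t4/b2b-balaban-t4-ne9-p1/g32/Q-S15-ANSWER-NE9-g32.md`)

HONEST FRAMING (T4-DAG PAGE 1).  Rung (B)+1 of the FINITE-VOLUME T⁴ programme — NOT infinite volume, NOT a mass gap, NOT the
Clay problem.  NE9 (`T4OutputRate.NE9` ∧ `FadingMemory`) is a cell NEW ESTIMATE, NOT PRINTED in [I] = [Balaban1987RG1]
(CMP **109**), [II] = [Balaban1988RG2Cluster] (CMP **116**), and NOT PROVED for Bałaban's E^{(j)} («NE9 ⇐ the named binders»;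
0∕18 leaves instantiated on Bałaban's objects; spine PROVED 0∕9).  HONEST DEPENDENCY (cell line, verbatim): continuum YM on T⁴ ⇐
BetaPertH ∧ nine spine estimates (0/9 proved); BetaPertH ⇐ (D1) ∧ (D4) ∧ CAP+tail; G-an2-4 gates asym, D1 and NE2/3/4.
`FlowStep.BetaPertH`, (B), (B^μ) do not occur.  Elementary real∕normed-space arithmetic on LETTERS; no definition, no estimate of
any object of the series; quotations for TYPES only (ABSOLUTE RULE).  0 sorry.

THE QUESTION (typer MAP v0.6.1 §5 Q-S15).  The substrate's VECJ-H radius `CovariantVectorCoerciveHolo.holoRadius` (p3) is chosen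
BY CONTINUITY, per level `n = lev L k` and per reference field `R⁰`; p3's honest explicit sizes in the UNSCALED chart variable `A`
(`expChart R⁰ A = exp(A)·R⁰`) are `ρ_op ≍ γ∕(d·n²)` (operator-norm perturbation, the module's route) and `ρ_form ≍ √γ∕n`
(form-relative route) — `O(1)` only in Bałaban's SCALED variable `ηA`, `η = 1∕n` ([I] (1.11)–(1.18) pp. 262–263: `U′ = e^{iηA}`,
`|A| < α₁`).  May NE9's radius depend on the level — (a) yes, by continuity; (b) no, level-free via a scaled chart + an explicit radius?

THE ANSWER THIS FILE CERTIFIES (letters only).  NE9's radii ARE level-indexed by type (`CurData.R : C.Dom → ℝ` read at the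
SOURCE `x.1`, `C.scale x.1 = j`; `HoloRadiusCompat R ρ := ∀ X, R X ≤ ρ X` pointwise) — so (a) costs the typing nothing.  What the
END does with the radius is carried by LEVEL-FREE letters: the species-(a) gain `ϱ⁻¹ ≤ cdir · ℓ k j` (`CurData.Admissible.ϱ_inv_le`,
`Kp = 64·cdir⁵∕r_k`; print: [I] (3.54)–(3.55) p. 280 «|B| < α₁L^jη», `cdir ↔ α₁∕α₃`, `ℓ k j ↔ L^jη`) together with the domain
inclusion `MapsTo (cur …) (ball 0 ϱ) (ball 0 (R x.1))` ([I] Lemma 4 (3.53) p. 280, TYPE).  For the linearised slice curve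
`τ ↦ τ • B` (the abelian case of T6's `σ′ ↦ Ψ_X(σ′ • B)`, `NE9CurveFromBackgroundMap`) with a step-`k` fluctuation seen at the
source level `j` of size `‖B‖ ≤ b · ℓ k j ∕ n_j` in the unscaled level-`j` chart:
* §1 `holoRadiusCompat_scaling` ∕ `le_of_holoRadiusCompat_scaling`: two radii of scaling form `α∕n_{lv X}`, `c∕n_{lv X}` are
  compatible IFF `α ≤ c` — a level-free SCALAR relation between prefactors (for Bałaban's domain `α₁∕n` against the form-relative
  `c(d,a′,|o|)·√γ∕n`: the smallness `α₁ ≤ c·√γ`, S-class, displayed; [I] Thm 1 p. 259 «α₁ sufficiently small»);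
  **`not_holoRadiusCompat_sq`**: against a radius with ONE MORE inverse power, `c∕n²` (the operator-norm size), a scaling-form
  radius `α∕n`, `α > 0`, is compatible at NO prefactor `c` once the levels are unbounded — the op-norm route can never carry
  Bałaban's domain;
* §2 **`gain_of_scalingForm`**: chart radius `ρ₀∕n_j` ⇒ the slice radius `ϱ := ρ₀∕(b·ℓ k j)` satisfies the domain inclusion AND
  `ϱ⁻¹ = (b∕ρ₀)·ℓ k j` — the END's gain letter `cdir := b∕ρ₀` is LEVEL-FREE; **`no_levelFree_gain_sq`**: chart radius `ρ₀∕n_j²`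
  ⇒ for a fluctuation of the exact size `b·ℓ k j∕n_j` every admissible slice radius has `ϱ⁻¹ ≥ (b·n_j∕ρ₀)·ℓ k j`, so NO level-free
  `cdir` exists once the levels are unbounded (`E := ℂ` suffices for the witness);
* §3 `lt_lev`, `exists_lt_lev`: the substrate's levels `lev L k` (`= L^k`) are unbounded for `2 ≤ L` — the hypothesis of the two
  no-gos holds for the tower of record (`…_lev` corollaries).
CONSEQUENCE (sheet §3): (a) STANDS for the type; a radius BY CONTINUITY (no size, no uniformity in `R⁰`) serves the K-wiring at form
level (`exists_ball_differentiableOn_rawTKernel`, `exists_ball_differentiableOn_covAtT_family`) and nothing in the END's letters;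
the explicit radius NE9 can use is p3's FORM-RELATIVE one (`≥ c·√γ∕lev k`, uniform over unitary `R⁰`) — REQUESTED, not blocking;
the scaled chart `expChartS` is NOT needed by NE9.  DISGUISE TEST: letters and a toy curve; nothing of Bałaban's; not NE9.

References (TYPES ∕ loci only): [Balaban1987RG1] T. Bałaban, CMP **109** (1987) 249–301, (1.11)–(1.18) pp. 262–263, Thm 1 p. 259,
(3.53)–(3.55) p. 280; [Balaban1988RG2Cluster] T. Bałaban, CMP **116** (1988) 1–22, (1.22)–(1.25) p. 7.  Summits-side NEW work
(LEAN PLACEMENT RULE); imports substrate-p3's `CovariantVectorCoerciveHolo` (the N-1 name `HoloRadiusCompat`) BY NAME; modifies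
nothing.  Value = a typing question of the row's instantiation answered with its reason in the kernel, NOT summit progress.
-/

noncomputable section

namespace Summit.QuantumFields.BalabanUV.T4Continuum.NE9ChartRadiusScaling

open Metric Set
open Literature.MathematicalPhysics.QuantumFieldTheory.Balaban1983to89.B5G183RateUnitTower (lev)
open Summit.QuantumFields.BalabanUV.T4Continuum.CovariantVectorCoerciveHolo (HoloRadiusCompat)

/-! ## §1 Compatibility of scaling-form radii is a level-free scalar inequality; one more power of `1∕n` is never compatible -/

section Compat

variable {Dom : Type*} (lv : Dom → ℕ) {n : ℕ → ℝ}

/-- [folklore] **SCALING-FORM RADII ARE COMPATIBLE IFF THEIR PREFACTORS ARE (⇐).**  `α ≤ c` ⇒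
`HoloRadiusCompat (X ↦ α∕n_{lv X}) (X ↦ c∕n_{lv X})` for positive levels. -/
theorem holoRadiusCompat_scaling (hn : ∀ j, 0 < n j) {α c : ℝ} (h : α ≤ c) :
    HoloRadiusCompat (fun X => α / n (lv X)) (fun X => c / n (lv X)) :=
  fun X => div_le_div_of_nonneg_right h (hn (lv X)).le

/-- [folklore] **… (⇒).**  If some domain exists, compatibility of the scaling-form radii forces `α ≤ c`. -/
theorem le_of_holoRadiusCompat_scaling (hn : ∀ j, 0 < n j) {α c : ℝ} (X₀ : Dom)
    (h : HoloRadiusCompat (fun X => α / n (lv X)) (fun X => c / n (lv X))) : α ≤ c := by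
  have hX := h X₀
  dsimp only at hX
  exact (div_le_div_iff_of_pos_right (hn (lv X₀))).mp hX

/-- [folklore] The two directions as an `iff` (given a domain). -/
theorem holoRadiusCompat_scaling_iff (hn : ∀ j, 0 < n j) {α c : ℝ} (X₀ : Dom) :
    HoloRadiusCompat (fun X => α / n (lv X)) (fun X => c / n (lv X)) ↔ α ≤ c :=
  ⟨le_of_holoRadiusCompat_scaling lv hn X₀, holoRadiusCompat_scaling lv hn⟩

/-- [folklore] **ONE MORE INVERSE POWER OF THE LEVEL IS NEVER COMPATIBLE.**  If the levels are unbounded along the domains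
(`∀ N, ∃ X, N < n_{lv X}`) and `0 < α`, then for NO prefactor `c` is the scaling-form radius `α∕n` dominated by `c∕n²` — the
operator-norm size `γ∕(d·n²)` cannot carry a domain of Bałaban's size `α₁∕n` at any smallness of `α₁ > 0`. -/
theorem not_holoRadiusCompat_sq (hn : ∀ j, 0 < n j) (hunb : ∀ N : ℝ, ∃ X : Dom, N < n (lv X)) {α : ℝ} (hα : 0 < α)
    (c : ℝ) : ¬ HoloRadiusCompat (fun X => α / n (lv X)) (fun X => c / n (lv X) ^ 2) := by
  intro h
  obtain ⟨X, hX⟩ := hunb (c / α)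
  have hnX : 0 < n (lv X) := hn (lv X)
  have hle : α / n (lv X) ≤ c / n (lv X) ^ 2 := h X
  -- α∕n ≤ c∕n² ⟺ α·n ≤ c
  have hmul : α * n (lv X) ≤ c := by
    have h2 : 0 < n (lv X) ^ 2 := pow_pos hnX 2
    have := (div_le_div_iff₀ hnX h2).mp hle
    -- α · n² ≤ c · n
    nlinarith
  have hlt : c < α * n (lv X) := by
    have := (div_lt_iff₀ hα).mp hX
    linarith [mul_comm α (n (lv X))]
  exact absurd hmul (not_le.mpr hlt)

end Compat

/-! ## §2 The gain letter of the species-(a) binder under the scaling form, and its failure with one more power -/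

section Gain

variable {E : Type*} [NormedAddCommGroup E] [NormedSpace ℂ E]

/-- [folklore] The linearised slice curve `τ ↦ τ • B` maps the disc of radius `ϱ` into the ball of radius `R > 0` as soon as
`ϱ · ‖B‖ ≤ R`. -/
theorem mapsTo_smul_ball {B : E} {ϱ R : ℝ} (hR : 0 < R) (h : ϱ * ‖B‖ ≤ R) :
    MapsTo (fun τ : ℂ => τ • B) (ball (0:ℂ) ϱ) (ball (0:E) R) := by
  intro τ hτ
  rw [mem_ball, dist_zero_right] at hτ ⊢
  rw [norm_smul]
  rcases (norm_nonneg B).eq_or_lt with hB | hB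
  · rw [← hB, mul_zero]; exact hR
  · exact lt_of_lt_of_le (mul_lt_mul_of_pos_right hτ hB) h

/-- [folklore] Conversely, if the curve `τ ↦ τ • B` (`B ≠ 0`) maps the disc of radius `ϱ > 0` into the ball of radius `R`, then
`ϱ · ‖B‖ ≤ R` (test the real points `0 ≤ t < ϱ`). -/
theorem mul_norm_le_of_mapsTo_smul_ball {B : E} (hB : B ≠ 0) {ϱ R : ℝ} (hϱ : 0 < ϱ)
    (h : MapsTo (fun τ : ℂ => τ • B) (ball (0:ℂ) ϱ) (ball (0:E) R)) : ϱ * ‖B‖ ≤ R := by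
  have hBpos : 0 < ‖B‖ := norm_pos_iff.mpr hB
  have key : ∀ t : ℝ, 0 ≤ t → t < ϱ → t * ‖B‖ < R := by
    intro t ht0 ht
    have hmem : (t : ℂ) ∈ ball (0:ℂ) ϱ := by
      rw [mem_ball, dist_zero_right, Complex.norm_real, Real.norm_eq_abs, abs_of_nonneg ht0]; exact ht
    have := h hmem
    rwa [mem_ball, dist_zero_right, norm_smul, Complex.norm_real, Real.norm_eq_abs, abs_of_nonneg ht0] at this
  rcases le_or_gt (ϱ * ‖B‖) R with hle | hlt
  · exact hle
  exfalso
  have hRdiv : R / ‖B‖ < ϱ := (div_lt_iff₀ hBpos).mpr hlt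
  set t : ℝ := max 0 ((R / ‖B‖ + ϱ) / 2) with ht
  have ht0 : 0 ≤ t := le_max_left _ _
  have htϱ : t < ϱ := max_lt hϱ (by linarith)
  have htR : R / ‖B‖ < t := lt_of_lt_of_le (by linarith) (le_max_right _ _)
  have hRt : R < t * ‖B‖ := (div_lt_iff₀ hBpos).mp htR
  exact absurd (key t ht0 htϱ) (not_lt.mpr hRt.le)

variable {n : ℕ → ℝ} {ℓ : ℕ → ℕ → ℝ} {ρ₀ b : ℝ}

/-- [folklore] **THE GAIN LETTER IS LEVEL-FREE UNDER THE SCALING FORM.**  Chart radius `ρ₀∕n_j` at the source level `j`, a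
step-`k` fluctuation seen at level `j` of size `‖B‖ ≤ b·ℓ k j∕n_j` (`b, ρ₀, n_j, ℓ k j > 0`): the slice radius `ϱ := ρ₀∕(b·ℓ k j)`
satisfies the domain inclusion of `CurData.Admissible.cur_an` for the linearised curve AND the gain `ϱ⁻¹ ≤ cdir·ℓ k j` with the
LEVEL-FREE `cdir := b∕ρ₀` (print's `α₁∕α₃`, [I] (3.54)–(3.55) p. 280 — TYPE only). -/
theorem gain_of_scalingForm (hn : ∀ j, 0 < n j) (hℓ : ∀ k j, 0 < ℓ k j) (hρ₀ : 0 < ρ₀) (hb : 0 < b) (k j : ℕ) {B : E}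
    (hB : ‖B‖ ≤ b * ℓ k j / n j) :
    MapsTo (fun τ : ℂ => τ • B) (ball (0:ℂ) (ρ₀ / (b * ℓ k j))) (ball (0:E) (ρ₀ / n j)) ∧
      (ρ₀ / (b * ℓ k j))⁻¹ ≤ (b / ρ₀) * ℓ k j := by
  have hbl : 0 < b * ℓ k j := mul_pos hb (hℓ k j)
  refine ⟨mapsTo_smul_ball (div_pos hρ₀ (hn j)) ?_, le_of_eq ?_⟩
  · calc ρ₀ / (b * ℓ k j) * ‖B‖ ≤ ρ₀ / (b * ℓ k j) * (b * ℓ k j / n j) :=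
          mul_le_mul_of_nonneg_left hB (div_pos hρ₀ hbl).le
      _ = ρ₀ / n j := by rw [div_mul_div_comm, mul_comm ρ₀ (b * ℓ k j), mul_div_mul_left ρ₀ (n j) hbl.ne']
  · rw [inv_div, div_mul_eq_mul_div, mul_comm b (ℓ k j)]

/-- [folklore] **WITH ONE MORE INVERSE POWER NO LEVEL-FREE GAIN EXISTS** (witness at `E := ℂ`).  Chart radius `ρ₀∕n_j²`; at each
`(k, j)` the fluctuation `B := b·ℓ k j∕n_j` of the exact admissible size; if the levels are unbounded then there is NO level-free
`cdir` such that every `(k, j)` admits a slice radius `ϱ > 0` with the domain inclusion and `ϱ⁻¹ ≤ cdir·ℓ k j` — any admissible `ϱ`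
has `ϱ⁻¹ ≥ (b·n_j∕ρ₀)·ℓ k j` (any real `ρ₀`; for `ρ₀ ≤ 0` the chart ball is empty and already `(k, j) = (0, 0)` fails). -/
theorem no_levelFree_gain_sq (hn : ∀ j, 0 < n j) (hunb : ∀ N : ℝ, ∃ j, N < n j) (hℓ : ∀ k j, 0 < ℓ k j)
    (hb : 0 < b) :
    ¬ ∃ cdir : ℝ, ∀ k j : ℕ, ∃ ϱ : ℝ, 0 < ϱ ∧
      MapsTo (fun τ : ℂ => τ • ((b * ℓ k j / n j : ℝ) : ℂ)) (ball (0:ℂ) ϱ) (ball (0:ℂ) (ρ₀ / n j ^ 2)) ∧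
        ϱ⁻¹ ≤ cdir * ℓ k j := by
  rintro ⟨cdir, h⟩
  obtain ⟨j, hj⟩ := hunb (cdir * ρ₀ / b)
  obtain ⟨ϱ, hϱ, hmaps, hgain⟩ := h 0 j
  have hnj : 0 < n j := hn j
  have hbl : 0 < b * ℓ 0 j := mul_pos hb (hℓ 0 j)
  have hBne : ((b * ℓ 0 j / n j : ℝ) : ℂ) ≠ 0 := by
    rw [Ne, Complex.ofReal_eq_zero]; exact (div_pos hbl hnj).ne'
  have hle := mul_norm_le_of_mapsTo_smul_ball hBne hϱ hmaps
  rw [Complex.norm_real, Real.norm_eq_abs, abs_of_pos (div_pos hbl hnj)] at hle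
  -- (1) ϱ · (bℓ) · n ≤ ρ₀
  have h1 : ϱ * (b * ℓ 0 j) * n j ≤ ρ₀ := by
    have h' : ϱ * (b * ℓ 0 j / n j) * n j ^ 2 ≤ ρ₀ := (le_div_iff₀ (pow_pos hnj 2)).mp hle
    have heq : ϱ * (b * ℓ 0 j / n j) * n j ^ 2 = ϱ * (b * ℓ 0 j) * n j := by
      field_simp
    linarith [heq ▸ h']
  -- (2) 1 ≤ ϱ · cdir · ℓ
  have h2 : 1 ≤ ϱ * (cdir * ℓ 0 j) := by
    have := mul_le_mul_of_nonneg_left hgain hϱ.le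
    rwa [mul_inv_cancel₀ hϱ.ne'] at this
  -- (3) cdir · ρ₀ < n · b
  have h3 : cdir * ρ₀ < n j * b := (div_lt_iff₀ hb).mp hj
  have hcdir : 0 < cdir := by
    rcases lt_or_ge 0 cdir with hc | hc
    · exact hc
    · have : ϱ * (cdir * ℓ 0 j) ≤ 0 :=
        mul_nonpos_of_nonneg_of_nonpos hϱ.le (mul_nonpos_of_nonpos_of_nonneg hc (hℓ 0 j).le)
      linarith
  have h4 : b * n j ≤ ϱ * (cdir * ℓ 0 j) * (b * n j) := le_mul_of_one_le_left (mul_pos hb hnj).le h2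
  have h5 : ϱ * (cdir * ℓ 0 j) * (b * n j) = cdir * (ϱ * (b * ℓ 0 j) * n j) := by ring
  have h6 : cdir * (ϱ * (b * ℓ 0 j) * n j) ≤ cdir * ρ₀ := mul_le_mul_of_nonneg_left h1 hcdir.le
  rw [h5] at h4
  linarith

end Gain

/-! ## §3 The substrate's levels `lev L k` are unbounded: the no-gos apply to the tower of record -/

section Levels

/-- [folklore] `k < lev L k` for `2 ≤ L` (the substrate's level sequence `n₀ = 1`, `n_{k+1} = L·n_k`, `B5G183RateUnitTower.lev`;
its closed form `lev L k = L^k` is `VariationalDelKBridge.lev_eq_pow`, not needed here). -/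
theorem lt_lev {L : ℕ} (hL : 2 ≤ L) (k : ℕ) : k < lev L k := by
  induction k with
  | zero => exact Nat.one_pos
  | succ k ih =>
      show k + 1 < L * lev L k
      have h1 : k + 1 ≤ lev L k := ih
      calc k + 1 < 2 * (k + 1) := by omega
        _ ≤ L * lev L k := Nat.mul_le_mul hL h1

/-- [folklore] For `2 ≤ L` the levels are unbounded: every real `N` is exceeded by some `lev L k`. -/
theorem exists_lt_lev {L : ℕ} (hL : 2 ≤ L) (N : ℝ) : ∃ k : ℕ, N < (lev L k : ℝ) :=
  ⟨⌈N⌉₊, lt_of_le_of_lt (Nat.le_ceil N) (by exact_mod_cast lt_lev hL ⌈N⌉₊)⟩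

/-- [folklore] `0 < lev L k` as a real, for `2 ≤ L`. -/
theorem lev_pos_real {L : ℕ} (hL : 2 ≤ L) (k : ℕ) : 0 < (lev L k : ℝ) := by
  exact_mod_cast lt_of_le_of_lt (Nat.zero_le k) (lt_lev hL k)

/-- [folklore] **§1's no-go on the tower of record**: for `2 ≤ L` and `0 < α`, the scaling-form radius `α∕lev L k` is dominated by
`c∕(lev L k)²` for NO `c` (domains indexed by their level, `lv := id`). -/
theorem not_holoRadiusCompat_sq_lev {L : ℕ} (hL : 2 ≤ L) {α : ℝ} (hα : 0 < α) (c : ℝ) :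
    ¬ HoloRadiusCompat (fun k : ℕ => α / (lev L k : ℝ)) (fun k => c / (lev L k : ℝ) ^ 2) :=
  not_holoRadiusCompat_sq (Dom := ℕ) id (n := fun k => (lev L k : ℝ)) (lev_pos_real hL)
    (fun N => exists_lt_lev hL N) hα c

/-- [folklore] **§2's no-go on the tower of record**: for `2 ≤ L`, chart radii `ρ₀∕(lev L j)²` admit no level-free gain letter. -/
theorem no_levelFree_gain_sq_lev {L : ℕ} (hL : 2 ≤ L) {ℓ : ℕ → ℕ → ℝ} {ρ₀ b : ℝ} (hℓ : ∀ k j, 0 < ℓ k j)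
    (hb : 0 < b) :
    ¬ ∃ cdir : ℝ, ∀ k j : ℕ, ∃ ϱ : ℝ, 0 < ϱ ∧
      MapsTo (fun τ : ℂ => τ • ((b * ℓ k j / (lev L j : ℝ) : ℝ) : ℂ)) (ball (0:ℂ) ϱ)
          (ball (0:ℂ) (ρ₀ / (lev L j : ℝ) ^ 2)) ∧
        ϱ⁻¹ ≤ cdir * ℓ k j :=
  no_levelFree_gain_sq (n := fun j => (lev L j : ℝ)) (lev_pos_real hL) (fun N => exists_lt_lev hL N) hℓ hb

/-- [folklore] **§2's positive half on the tower of record**: chart radii `ρ₀∕lev L j` give the level-free gain `cdir := b∕ρ₀`. -/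
theorem gain_of_scalingForm_lev {E : Type*} [NormedAddCommGroup E] [NormedSpace ℂ E] {L : ℕ} (hL : 2 ≤ L)
    {ℓ : ℕ → ℕ → ℝ} {ρ₀ b : ℝ} (hℓ : ∀ k j, 0 < ℓ k j) (hρ₀ : 0 < ρ₀) (hb : 0 < b) (k j : ℕ) {B : E}
    (hB : ‖B‖ ≤ b * ℓ k j / (lev L j : ℝ)) :
    MapsTo (fun τ : ℂ => τ • B) (ball (0:ℂ) (ρ₀ / (b * ℓ k j))) (ball (0:E) (ρ₀ / (lev L j : ℝ))) ∧
      (ρ₀ / (b * ℓ k j))⁻¹ ≤ (b / ρ₀) * ℓ k j :=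
  gain_of_scalingForm (n := fun j => (lev L j : ℝ)) (lev_pos_real hL) hℓ hρ₀ hb k j hB

end Levels

end Summit.QuantumFields.BalabanUV.T4Continuum.NE9ChartRadiusScaling

end
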